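/-
Copyright (c) 2026 the pub-hodgecm-mathlib formalisation cell (harness21).  Prover seat hodgecm-mathlib-K2E3-p28 (g2), HCML Track B «K2-LIT» ∕ h413
(`stmt-HodgeConjecture-24833`), line `K2_E3_EllipticInputs`, L4 `stub_StCharTS`, PART «LIEA3» ED. 1 leaf (LAU-le1): the (L-A_U)′ «local character expansion at `1`
in `T̂`-form» on `𝔲(σ_w, H_w)` for the ABELIAN groups `U(σ_w, H_w)(L_w)`, `N ≤ 1` — every admissible irreducible `r₀` is finite-dimensional, so (LAU-fin) applies.  2026-09-04.
-/
import Summits.HodgeConjecture.HodgeConjecture.Theorems.K2E3ULieCharExpansionAtOneFinDim      -- ★ p861546 (this seat): (LAU-fin) `uLieCharExpansionAtOne_of_finiteDim`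
import Summits.HodgeConjecture.HodgeConjecture.Theorems.K2E3CharLocIntNearSemisimpleLeOne    -- ★ (K2E3-p11): `matrix_mul_comm_of_le_one`; brings ★ J3 `finite_of_isIrreducible_of_center_mul_isCompact` (`Literature…SmoothIrrepAbelianByCompactFinite`)
import Summits.HodgeConjecture.HodgeConjecture.Theorems.K2E3GLnIntegerPointsHaarVsAddHaar    -- ★ `secondCountableTopology_gl`
import HarnessLib

/-!
# K2_E3 road (h413), PART «LIEA3» leaf (LAU-le1) — (L-A_U)′ «local character expansion at `1`» for `U(σ_w, H_w)(L_w)`, `N ≤ 1`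

Cell `pub/hodgecm-mathlib` (D-0151), Track B (21-frontier RULING «PUSH BOTH» 2026-09-03, director req624, CLOSE-OUT ROSTER l.72907 strike line L4 `stub_StCharTS`),
seat K2E3-p28 (g2).  `--supports stmt-HodgeConjecture-24833 --as helper`; THEOREMS ONLY (no definition ∕ instance ∕ notation ∕ named fact ∕ `sorry`); never imports
`Cruxes/…/Lines`.  PAYS the hosted leaf (LAU-le1) `U12Characters.sig_K2E3ULieCharExpansionAtOneLeOne` of PART «LIEA3» ED. 1 (K2E3-typ2 (g0) cand sha16 321f12f2244c5c8e
:102; = (L-A_U)′ «LIE» :401 with the binder `(N : ℕ) (H : …)` ↦ `(N : ℕ), N ≤ 1 → ∀ (H : …)`) BY NAME: the statement of `uLieCharExpansionAtOne_le_one` below is that socket's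
statement BYTE FOR BYTE.

MATHEMATICS.  For `N ≤ 1` the unitary group `U(σ_w, H_w)(L_w) ≤ GL_N(L_w)` is ABELIAN (`N × N` matrices over a commutative ring commute when `N ≤ 1`,
★ `matrix_mul_comm_of_le_one`), and second countable (★ `secondCountableTopology_gl`), so every IRREDUCIBLE smooth `r₀` is finite-dimensional: `U = Z(U)·{1}` and ★ J3
`finite_of_isIrreducible_of_center_mul_isCompact` (Schur's lemma in countable dimension) applies — §1, the one-place-model twin of ★
`K2E3CharLocIntNearSemisimpleLeOne.finite_smoothIrrep_cmDatum_local_of_le_one` [BushnellHenniart2006, §2.6 Cor. 1].  Then Harish-Chandra's local character expansion at `1` in `T̂`-form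
holds TRIVIALLY and EXACTLY with `T := dim r₀ · δ₀` — ★ p861546 (LAU-fin) `uLieCharExpansionAtOne_of_finiteDim` [HarishChandra1999, Thm. 16.3 p. 77, §21 p. 87] (§2).
* §1 `finite_smoothIrrep_unitary_le_one` — irreducible smooth representations of `U(σ_w, H_w)(L_w)`, `N ≤ 1`, are finite-dimensional (abelian + second countable ⇒ ★ J3).
* §2 **`uLieCharExpansionAtOne_le_one`** — the leaf (LAU-le1) VERBATIM.
[HarishChandra1999AdmissibleDistributions, Thm. 16.3 p. 77, §21 p. 87] [Howe1974, Prop. 3] [BushnellHenniart2006, §1.1, §2.6] [BernsteinZelevinsky1976, Def. 2.1 (b)].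
HONEST LABEL: HC_CM is proved only modulo the 7 printed citations (2 remaining named inputs: hLiu418 = stmt-HodgeConjecture-24832, h413 =
stmt-HodgeConjecture-24833) until rung 0 closes; count-neutral helper ((LAU-le1) is the `N ≤ 1` face of (L-A_U)′; (LAU-2), (LAU-3) XL stay OPEN; nothing here is on the
`stub_StCharTS` sorry count until the dealer ties PART «LIEA3»).

## References
* [HarishChandra1999AdmissibleDistributions] Harish-Chandra (DeBacker–Sally), *Admissible Invariant Distributions on Reductive p-adic Groups* (1999), Thm. 16.3, §21.
* [Howe1974] R. Howe, *The Fourier transform and germs of characters (case of GL_n over a p-adic field)*, Math. Ann. 208 (1974), Prop. 3.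
* [BushnellHenniart2006] C. J. Bushnell, G. Henniart, *The local Langlands conjecture for GL(2)* (2006), §1.1, §2.6.
* [BernsteinZelevinsky1976] I. N. Bernstein, A. V. Zelevinsky, *Representations of the group GL(n,F) where F is a non-archimedean local field*, Russ. Math. Surveys 31 (1976), Def. 2.1 (b).
-/

set_option autoImplicit false
set_option linter.dupNamespace false   -- `Summit.HodgeConjecture.HodgeConjecture.…` (D-0017 nested layout; lakefile exemption for Summits)

noncomputable section

open MeasureTheory Filter Topology NumberField IsDedekindDomain
open scoped Matrix MatrixGroups NNReal
open Literature.NumberTheory.Rogawski1990 Literature.NumberTheory.Automorphic Literature.NumberTheory.Automorphic.UnitaryGroup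
open Literature.NumberTheory.GaloisRepresentations Literature.NumberTheory.GaloisRepresentations.IsNonarchimedeanLocalField
open Summit.HodgeConjecture.HodgeConjecture.Cruxes.H413.K2E3LieUnitary
open Summit.HodgeConjecture.HodgeConjecture.Cruxes.H413.K2E3CharLocBddOfLocal
open Summit.HodgeConjecture.HodgeConjecture.Cruxes.H413.K2E3CharLocIntNearSemisimpleLeOne (matrix_mul_comm_of_le_one)
open Summit.HodgeConjecture.HodgeConjecture.Cruxes.H413.K2E3ULieCharExpansionAtOneFinDim

namespace Summit.HodgeConjecture.HodgeConjecture.Cruxes.H413.K2E3ULieCharExpansionAtOneLeOne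

section CM

variable (L : Type) [Field L] [NumberField L] [IsCMField L] {N : ℕ} (v : HeightOneSpectrum (𝓞 ↥(maximalRealSubfield L)))
  (w : UnitaryGroup.PlacesOver L v) (hw : IsCMField.complexConj L • w.1 = w.1) (H : Matrix (Fin N) (Fin N) L)

/-! ## §1  Admissible irreducible representations of the abelian groups `U(σ_w, H_w)(L_w)`, `N ≤ 1`, are finite-dimensional -/

/-- **An irreducible smooth representation of `U(σ_w, H_w)(L_w)`, `N ≤ 1`, is finite-dimensional** (admissibility is not even needed): the group is ABELIAN
(★ `matrix_mul_comm_of_le_one`: `N × N` matrices over a commutative ring commute when `N ≤ 1`) and second countable (★ `secondCountableTopology_gl`), so `U = Z(U)·{1}` with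
`{1}` compact and ★ J3 `finite_of_isIrreducible_of_center_mul_isCompact` (Schur's lemma in countable dimension: the whole group acts by scalars on the irreducible `V`, which
is then a line) applies — the one-place-model twin of ★ `K2E3CharLocIntNearSemisimpleLeOne.finite_smoothIrrep_cmDatum_local_of_le_one`. [cite: BushnellHenniart2006, §2.6 Corollary 1]
[cite: BernsteinZelevinsky1976, §2.1, Prop. 2.11] -/
theorem finite_smoothIrrep_unitary_le_one (hN : N ≤ 1)
    (r : SmoothIrrep ↥(unitaryGroupOfForm (galAdicCompletionMap (L := L) (IsCMField.complexConj L) hw) (UnitaryGroup.placeForm H w.1))) : Module.Finite ℂ r.V := by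
  haveI : T2Space (w.1.adicCompletion L) := (isLocalField (w.1.adicCompletion L)).toT2Space
  haveI : SecondCountableTopology (GL (Fin N) (w.1.adicCompletion L)) :=
    K2E3GLnIntegerPointsHaarVsAddHaar.secondCountableTopology_gl (F := w.1.adicCompletion L) (N := N)
  haveI : r.ρ.IsIrreducible := r.isIrreducible
  -- the group is abelian
  have hcomm : ∀ a b : ↥(unitaryGroupOfForm (galAdicCompletionMap (L := L) (IsCMField.complexConj L) hw) (UnitaryGroup.placeForm H w.1)), a * b = b * a := by
    intro a b
    apply Subtype.ext
    rw [Subgroup.coe_mul, Subgroup.coe_mul]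
    ext1
    rw [Units.val_mul, Units.val_mul]
    exact matrix_mul_comm_of_le_one hN _ _
  exact finite_of_isIrreducible_of_center_mul_isCompact r.ρ r.isSmooth isCompact_singleton fun g =>
    ⟨g, Subgroup.mem_center_iff.2 fun h => hcomm h g, 1, Set.mem_singleton 1, (mul_one g).symm⟩

end CM

/-! ## §2  The leaf (LAU-le1): (L-A_U)′ for `U(σ_w, H_w)(L_w)`, `N ≤ 1` -/

set_option maxHeartbeats 1600000 in
set_option synthInstance.maxHeartbeats 400000 in
open scoped Classical in
open MeasureTheory.Measure Filter Topology Polynomial Literature.NumberTheory.GaloisRepresentations.IsNonarchimedeanLocalField Summit.HodgeConjecture.HodgeConjecture.Cruxes.H413.K2E3LieUnitary in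
/-- **LEAF (LAU-le1) — (L-A_U)′ «local character expansion at `1` in `T̂`-form» on `𝔲(σ_w, H_w)` for `U(σ_w, H_w)(L_w)`, `N ≤ 1`** — the statement of PART «LIEA3» ED. 1
`U12Characters.sig_K2E3ULieCharExpansionAtOneLeOne` BYTE FOR BYTE (= (L-A_U)′ «LIE» :401 with `(N : ℕ) (H : …)` ↦ `(N : ℕ), N ≤ 1 → ∀ (H : …)`).  Every irreducible smooth
`r₀` of the abelian group `U(σ_w, H_w)(L_w)`, `N ≤ 1`, is finite-dimensional (§1), so ★ p861546 (LAU-fin) `uLieCharExpansionAtOne_of_finiteDim` applies (`T := dim r₀ · δ₀`).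
[cite: HarishChandra1999AdmissibleDistributions, Thm. 16.3 p. 77, §21 p. 87] [cite: Howe1974, Prop. 3] [cite: BushnellHenniart2006, §2.6] -/
theorem uLieCharExpansionAtOne_le_one :
    ∀ (L : Type) [Field L] [NumberField L] [IsCMField L] (N : ℕ), N ≤ 1 → ∀ (H : Matrix (Fin N) (Fin N) L),
      (H.map (cmConjRingHom L))ᵀ = H → H.det ≠ 0 →
      ∀ (v : HeightOneSpectrum (𝓞 ↥(maximalRealSubfield L))) (w : UnitaryGroup.PlacesOver L v) (hw : IsCMField.complexConj L • w.1 = w.1)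
      (ψ : AddChar (w.1.adicCompletion L) Circle), ψ.IsContinuousNontrivial →
      (∃ a : w.1.adicCompletion L, galAdicCompletionMap (L := L) (IsCMField.complexConj L) hw a = a ∧ ψ a ≠ 1) →
      ∀ [MeasurableSpace ↥(lieOfForm (galAdicCompletionMap (L := L) (IsCMField.complexConj L) hw) (UnitaryGroup.placeForm H w.1))]
        [BorelSpace ↥(lieOfForm (galAdicCompletionMap (L := L) (IsCMField.complexConj L) hw) (UnitaryGroup.placeForm H w.1))]
        (μ𝔤 : Measure ↥(lieOfForm (galAdicCompletionMap (L := L) (IsCMField.complexConj L) hw) (UnitaryGroup.placeForm H w.1))) [μ𝔤.IsAddHaarMeasure]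
        [MeasurableSpace ↥(unitaryGroupOfForm (galAdicCompletionMap (L := L) (IsCMField.complexConj L) hw) (UnitaryGroup.placeForm H w.1))]
        [BorelSpace ↥(unitaryGroupOfForm (galAdicCompletionMap (L := L) (IsCMField.complexConj L) hw) (UnitaryGroup.placeForm H w.1))]
        (μ₀ : Measure ↥(unitaryGroupOfForm (galAdicCompletionMap (L := L) (IsCMField.complexConj L) hw) (UnitaryGroup.placeForm H w.1))) [μ₀.IsHaarMeasure]
        (r₀ : SmoothIrrep ↥(unitaryGroupOfForm (galAdicCompletionMap (L := L) (IsCMField.complexConj L) hw) (UnitaryGroup.placeForm H w.1))), r₀.ρ.IsAdmissible →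
        ∀ Θ₀ : ↥(unitaryGroupOfForm (galAdicCompletionMap (L := L) (IsCMField.complexConj L) hw) (UnitaryGroup.placeForm H w.1)) → ℂ,
        (∀ x₀ : ↥(unitaryGroupOfForm (galAdicCompletionMap (L := L) (IsCMField.complexConj L) hw) (UnitaryGroup.placeForm H w.1)),
          IsRegularElt (x₀ : GL (Fin N) (w.1.adicCompletion L)) → ∀ᶠ y in 𝓝 x₀, Θ₀ y = Θ₀ x₀) →
        (∀ φ₀ : ↥(unitaryGroupOfForm (galAdicCompletionMap (L := L) (IsCMField.complexConj L) hw) (UnitaryGroup.placeForm H w.1)) → ℂ,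
          IsLocSmooth φ₀ → (IrrClass.mk r₀).smoothTrace μ₀ φ₀ = ∫ x, φ₀ x * Θ₀ x ∂μ₀) →
      ∃ V : Set (Matrix (Fin N) (Fin N) (w.1.adicCompletion L)), V ∈ 𝓝 (0 : Matrix (Fin N) (Fin N) (w.1.adicCompletion L)) ∧
      ∃ T : (↥(lieOfForm (galAdicCompletionMap (L := L) (IsCMField.complexConj L) hw) (UnitaryGroup.placeForm H w.1)) → ℂ) → ℂ,
        ((∀ f₁ f₂ : ↥(lieOfForm (galAdicCompletionMap (L := L) (IsCMField.complexConj L) hw) (UnitaryGroup.placeForm H w.1)) → ℂ, IsLocSmooth f₁ → IsLocSmooth f₂ → T (f₁ + f₂) = T f₁ + T f₂) ∧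
         (∀ (a : ℂ) (f : ↥(lieOfForm (galAdicCompletionMap (L := L) (IsCMField.complexConj L) hw) (UnitaryGroup.placeForm H w.1)) → ℂ), IsLocSmooth f → T (a • f) = a * T f) ∧
         (∀ (x : ↥(unitaryGroupOfForm (galAdicCompletionMap (L := L) (IsCMField.complexConj L) hw) (UnitaryGroup.placeForm H w.1))) (f : ↥(lieOfForm (galAdicCompletionMap (L := L) (IsCMField.complexConj L) hw) (UnitaryGroup.placeForm H w.1)) → ℂ), IsLocSmooth f →
            T (fun X => f ⟨((x : GL (Fin N) (w.1.adicCompletion L)) : Matrix (Fin N) (Fin N) (w.1.adicCompletion L)) * X.1 * (((x : GL (Fin N) (w.1.adicCompletion L))⁻¹ : GL (Fin N) (w.1.adicCompletion L)) : Matrix (Fin N) (Fin N) (w.1.adicCompletion L)),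
              conj_mem_lieOfForm x.2 X.2⟩) = T f) ∧
         (∀ f : ↥(lieOfForm (galAdicCompletionMap (L := L) (IsCMField.complexConj L) hw) (UnitaryGroup.placeForm H w.1)) → ℂ, IsLocSmooth f → (∀ X ∈ tsupport f, ¬ IsNilpotent X.1) → T f = 0)) ∧
        ∀ Fn : ↥(lieOfForm (galAdicCompletionMap (L := L) (IsCMField.complexConj L) hw) (UnitaryGroup.placeForm H w.1)) → ℂ,
          (∀ f : ↥(lieOfForm (galAdicCompletionMap (L := L) (IsCMField.complexConj L) hw) (UnitaryGroup.placeForm H w.1)) → ℂ, IsLocSmooth f → T (lieFourier (galAdicCompletionMap (L := L) (IsCMField.complexConj L) hw) (UnitaryGroup.placeForm H w.1) (fun x : w.1.adicCompletion L => ((ψ x : Circle) : ℂ)) μ𝔤 f) = ∫ X, f X * Fn X ∂μ𝔤) →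
          (∀ X : ↥(lieOfForm (galAdicCompletionMap (L := L) (IsCMField.complexConj L) hw) (UnitaryGroup.placeForm H w.1)), IsUnit X.1.charpoly.discr → ∀ᶠ Y in 𝓝 X, Fn Y = Fn X) →
          ∀ g : ↥(unitaryGroupOfForm (galAdicCompletionMap (L := L) (IsCMField.complexConj L) hw) (UnitaryGroup.placeForm H w.1)), ∀ Y : ↥(lieOfForm (galAdicCompletionMap (L := L) (IsCMField.complexConj L) hw) (UnitaryGroup.placeForm H w.1)), Y.1 ∈ V → IsUnit Y.1.charpoly.discr → IsUnit (1 - Y.1) → IsUnit (1 + Y.1) →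
            ((g : GL (Fin N) (w.1.adicCompletion L)) : Matrix (Fin N) (Fin N) (w.1.adicCompletion L)) = (1 + Y.1) * (1 - Y.1)⁻¹ → Θ₀ g = Fn Y := by
  intro L _ _ _ N hN H hH hdet v w hw ψ hψ hψfix _ _ μ𝔤 _ _ _ μ₀ _ r₀ hadm Θ₀ hloc hrep
  exact uLieCharExpansionAtOne_of_finiteDim L N H hH hdet v w hw ψ hψ hψfix μ𝔤 μ₀ r₀ hadm
    (finite_smoothIrrep_unitary_le_one L v w hw H hN r₀) Θ₀ hloc hrep

end Summit.HodgeConjecture.HodgeConjecture.Cruxes.H413.K2E3ULieCharExpansionAtOneLeOne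

end
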